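import Mathlib
import Summits.Ventures.PercRepro2.LocRows
import Summits.Ventures.PercRepro2.SwRow

/-!
# The pairing form of row (SW): a symmetric involution of `Q`
(blind cell PercRepro2, night-4 g3, 2026-08-24T08:3xZ; proofs/NIGHT4-SW.md §6)

Census (exact, Edmonds blossom with the pendant/dummy device of g0's `involU.py`; all connected graphs,
every marking with `Q ≠ ∅`): on `Q = tgtU ends l h {S ∣ o ∈ S} = {h ∉ H_l, o ∈ R_side(l)}` there is an
INVOLUTION `τ` with `C_R(h)(ζ) ⊆ C_B(h)(τ ζ)` and `C_R(h)(τ ζ) ⊆ C_B(h)(ζ)` — partners' red clusters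
of `h` lie inside each other's blue clusters of `h` (a fixed point iff `C_R(h)(ζ) ⊆ C_B(h)(ζ)`) — in
all 42 / 460 / 5,633 cases at `n = 4 / 5 / 6`; the same with the extra symmetric clauses
`C_B(l)(τ ζ) ⊆ C_R(l)(ζ)`, `C_B(l)(ζ) ⊆ C_R(l)(τ ζ)` and "`τ ζ` is the colour swap of `ζ` off the
edges touching `H_l(ζ) ∪ H_l(τ ζ)`" (n ≤ 6, 0 failures; `n = 7` on kit).  The hull swap of
`HullSwap.lean` is such an involution on the configurations whose red cluster of `h` avoids the blue
side of `l`.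

* `SwPair` — the involution form (statement only); `sw_of_swPair` — it gives row (SW), hence the
  free-fibre row 2′DOM for every up-set and (BASE).  Like g0's `PairU` for the local relation, the
  pairing is the sharper, census-true shape of the open statement.  (The hull swap of
  `HullSwap.lean` is such a pairing on the configurations whose red cluster of `h` avoids the blue
  side of `l`.)
-/

namespace Summit.Ventures.PercRepro2

namespace LocRows

open Hull

variable {V : Type*} {E : Type*} [Fintype E] [DecidableEq E]

open scoped Classical

variable (ends : E → Sym2 V)

/-- **The pairing form of (SW)**: an involution of `Q` under which partners' red clusters of `h`
lie inside each other's blue clusters of `h`. -/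
def SwPair (l h o : V) : Prop :=
  ∃ τ : Config E → Config E,
    (∀ ζ ∈ tgtU ends l h {S : Set V | o ∈ S}, τ ζ ∈ tgtU ends l h {S : Set V | o ∈ S}) ∧
    (∀ ζ ∈ tgtU ends l h {S : Set V | o ∈ S}, τ (τ ζ) = ζ) ∧
    ∀ ζ ∈ tgtU ends l h {S : Set V | o ∈ S},
      cluster ends ζ h ⊆ cluster ends (blue (τ ζ)) h ∧
      cluster ends (τ ζ) h ⊆ cluster ends (blue ζ) h

/-- The pairing form gives row (SW). -/
theorem sw_of_swPair (l h o : V) (hp : SwPair ends l h o) : Sw ends l h o := by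
  obtain ⟨τ, hmem, hinv, hcl⟩ := hp
  refine ⟨fun x => τ x.1, ?_, fun x => ⟨hmem x.1 x.2, (hcl x.1 x.2).1⟩⟩
  intro x y hxy
  have h1 : τ (τ x.1) = τ (τ y.1) := congrArg τ hxy
  rw [hinv x.1 x.2, hinv y.1 y.2] at h1
  exact Subtype.ext h1

/-- The pairing form over all finite graphs and markings. -/
def SwPair_all : Prop :=
  ∀ (V E : Type) [Fintype V] [DecidableEq V] [Fintype E] [DecidableEq E] (ends : E → Sym2 V)
    (l h o : V), l ≠ h → o ≠ l → o ≠ h → SwPair ends l h o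

/-- `SwPair_all` gives `Sw_all`. -/
theorem sw_all_of_swPair_all (hp : SwPair_all) : Sw_all := by
  intro V E _ _ _ _ ends l h o hlh hol hoh
  exact sw_of_swPair ends l h o (hp V E ends l h o hlh hol hoh)

end LocRows

end Summit.Ventures.PercRepro2
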